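/-
Copyright (c) 2026. All rights reserved.
Released under Apache 2.0 license as described in the file LICENSE.
-/
import Literature.AlgebraicGeometry.Pohlmann1968.CMTypeRankCharactersNumberField
import Mathlib.RingTheory.RootsOfUnity.Complex
import HarnessLib

/-!
# Lenstra's theorem (White 1993, Lemma 3 and Theorem 3), group level: a DEGENERATE CM type of a finite ABELIAN
# group carries a SPORADIC subset — a Galois-balanced set of embeddings which is not a union of conjugate pairs

S. P. White, *Sporadic cycles on CM abelian varieties*, Compositio Math. **88** (1993) 123–142
[White1993SporadicCycles] (open access on NUMDAM, `CM_1993__88_2_123_0`; held text `paper:url-2830691ae55d`, 21 pp.,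
read in full; page files p0002 = p. 123, …, p0021 = p. 142).

## The print

§1 (p. 123): "Let `A` be an abelian variety of dimension `d` with complex multiplication by a CM-field `K` of degree
`2d`. … Consider the following two conditions (i) `dim(M_A) = d + 1`, (ii) The ring of Hodge cycles on `A` is
generated by classes of divisors. … The criterion of Pohlmann immediately shows that (i) implies (ii). Between 1977
and 1978, K. Ribet asked whether (i) and (ii) were equivalent. H. W. Lenstra, Jr., quickly showed that the
conditions were indeed equivalent under the supplementary hypothesis that `K` is abelian over `ℚ` (see Theorem 3)."
p. 124: "subsets `Δ ⊂ G/H` such that [Pohlmann's condition] correspond to … lines in `H^{p,p}(A, ℂ) ∩ H^{2p}(A, ℚ) ⊗ ℂ`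
which are not generated by cup products from `H^{1,1}(A, ℂ) ∩ H²(A, ℚ) ⊗ ℂ`. We call such subsets sporadic.
Clearly condition (ii) … is equivalent to the absence of any sporadic `Δ`."

§4 (K Galois, p. 130): "We have converted the question of the existence of sporadic cycles into a question about
the existence of certain zero divisors in a group ring. Any element of `ℚ[G]⁻` whose coefficients are all `±1` can
be put in the form `S − cS`. Similarly, any element whose coefficients are `0, ±1` can [be] put in the form
`Δ⁻¹ − cΔ⁻¹`. If the product of the two is zero then the elements correspond to a CM-type for which there exists a
sporadic cycle. … However, if we consider higher powers `Aⁿ` of `A`, a sporadic cycle on `Aⁿ` would correspond to a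
right annihilator of `S − cS` in `ℚ[G]⁻` whose coefficients are `0, ±1, …, ±n`."  LEMMA 2 (p. 130): "Let `(K, S)`
be a Galois CM-type with Galois group `G` and central involution `c`. The rank of the corresponding Mumford–Tate
group is maximal if and only if `S − cS` is a `G`-module generator of `ℚ[G]⁻`."

LEMMA 3 (p. 131): "If `G` is abelian, every submodule `N` of `ℚ[G]⁻` has a nonzero element `β` whose coefficients
are `0, ±1`.  Proof. Since `G` is abelian `ℚ[G]⁻ ⊗ ℂ = ⊕_{χ odd} ℂ e_χ` where `e_χ = Σ_{g∈G} χ(g) g`. Because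
`N` is defined over `ℚ`, `N ⊗ ℂ ⊇ ⊕_{χ' conjugate to χ} ℂ e_{χ'}` for some odd `χ`. Let `H` be the kernel of `χ`.
Let `σ` generate the cyclic group `G/H` and assume `σ^m = c`, `σ^{2m} = 1`. Then `χ` generates the character group
of `G/H` and `χ` and `χᵗ` are conjugate ⟺ `(t, 2m) = 1`. Let `β = ∏_{p | 2m} (1 − σ^{2m/p})`. Then if an odd `χ'`
is not conjugate to `χ` then either `χ'(β) = 0` or `χ'(H) = 0`. In either case `χ'(βH) = 0` which implies that if
we let `β = βH`, … Furthermore, `β` has the appropriate coefficients since the order of a typical product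
`σ^{2m/p₁} ⋯ σ^{2m/p_t} H` is exactly `p₁ ⋯ p_t`, different for each product. This proves the lemma."

THEOREM 3 (Lenstra) (p. 131): "Let `(K, S)` be any simple CM-type, where `K` is a field with abelian Galois group.
If `A` is any abelian variety of CM type `(K, S)` then `rank(M) = dim(A) + 1` if and only if the ring of Hodge
cycles on `A` is generated by classes of images of divisors.  Proof. We need check only the case when
`rank(M) < dim(A) + 1`. By Lemma 2 this is equivalent to `S − cS` not generating `ℚ[G]⁻`. If `N` is the nontrivial
submodule generated by the right annihilators of `S − cS` then by Lemma 3, there exists an element in `N` whose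
coefficients are `0, ±1`. This can be rewritten in the form `Δ⁻¹ − cΔ⁻¹` which gives us a "line" `Δ` containing a
sporadic cycle on `A`."

§5 PROPOSITION 1 (p. 132), for `G = ℤ/2 × G₀`: "the following three conditions are equivalent. 1. The divisor
classes do not generate the Hodge ring of any abelian variety of CM-type `(K, S)`. 2. There exists a sporadic `Δ`.
3. There exists (nonzero) `β ∈ ℚ[G₀]` whose coefficients are `±1` or `0` such that `α · β = 0`."

## Setting and dictionary

As in `CMTypeRankCharacters` (Kubota's Lemma 2) and `DegenerateCMTypesCyclicTwoOddPrimes` (Hazama): `G` a finite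
COMMUTATIVE group acting on itself (the Galois group of an abelian CM field, `Hom(K, ℂ)` being a `G`-torsor),
`ρ ∈ G` the complex conjugation (White's `c`), `Φ ⊆ G` with `IsCMTypeWith ρ Φ` (White's `S`), characters
`χ : AddChar (Additive G) ℂ`, the rank `typeRank G Φ` (`= dim M_A`, White §3) and Pohlmann's condition
`IsBalanced G Φ f` on a weight `f : G → ℚ` (`CMTypeRank`).  A subset `Δ ⊆ G` is SPORADIC when `𝟙_Δ` is balanced
(`|gΔ ∩ S| = |gΔ ∩ cS|` for all `g`) and `Δ` is not a union of pairs `{x, cx}` (some `x ∈ Δ` has `cx ∉ Δ`) —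
for a simple type these index exactly Pohlmann's lines outside the divisor ring (Gordon 9.2.2, tree
`Pohlmann1968.exists_exceptional_iff_of_primitive`).  White's group-ring condition "`β` is a right annihilator of
`S − cS`" for an ODD `β` (`β(cx) = −β(x)`, i.e. `β ∈ ℚ[G]⁻`) reads `Σ_x β(x)·[gx ∈ S] = 0` for every `g`
(`sum_mul_antiVec_eq_two_mul`: against the tree's `±1`-vectors `antiVec = 𝟙_{g⁻¹S} − 𝟙_{g⁻¹cS}` the two conditions agree
because an odd `β` has `Σ_x β(x) = 0`).

WHITE'S `β` READ THROUGH THE CHARACTER.  For `N` with `χ(x)^N = 1` for all `x` (White: `N = 2m = |G/H|`; here any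
such `N`, e.g. `|G|`), put `ζ_p = e^{2πi/p}` and `z_T = ∏_{p∈T} ζ_p` for a set `T` of primes dividing `N`; then
`x ∈ σ^{Σ_{p∈T} N/p} H ⟺ χ(x) = z_T` (`whiteFun_eq_printed`), so White's `β = H · ∏_{p|N}(1 − σ^{N/p})
= Σ_T (−1)^{|T|} σ^{Σ_{p∈T} N/p} H` is the function `whiteFun N χ : x ↦ Σ_{T ⊆ primes(N)} (−1)^{|T|} [χ(x) = z_T]`,
which needs no generator `σ` (and is literally White's `β` when `χ(G) = μ_N`).

## What is proved (no `sorry`, no named fact; three definitions with bodies: `zeta`, `rootProd`, `whiteFun`,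
## and the finite set `whiteSet N χ = {x | whiteFun N χ x = 1}`)

* §1 `rootProd_injective_of_prime` — "the order of a typical product … is exactly `p₁⋯p_t`, different for each
  product": `T ↦ z_T` is injective on sets of primes.
* §2 `sum_pow_eq_zero_of_coprime` — "`χ` and `χᵗ` are conjugate ⟺ `(t, 2m) = 1`", in the form used: if `N`-th roots
  of unity `u_i` have `Σ u_i = 0` then `Σ u_iᵗ = 0` for every `t` prime to `N` (the cyclotomic polynomial is the
  minimal polynomial of `e^{2πi/N}`).
* §3 `whiteFun_mem_signs` (coefficients `0, ±1`), `whiteFun_one` (`β(1) = 1`, so `β ≠ 0`), `whiteFun_rho_mul`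
  (`β ∈ ℚ[G]⁻`: `β(cx) = −β(x)`), `whiteFun_eq_printed` (agreement with the printed `H ∏(1 − σ^{N/p})`), and the
  heart of Lemma 3, **`sum_whiteFun_mul_translateInd_eq_zero`**: if the odd character `χ` vanishes on `S`
  (`Σ_{s∈S} χ(s) = 0`) then `β` ANNIHILATES every translate of `S` — by Fourier inversion on `μ_N`,
  `N·Σ_x β(x)[gx ∈ S] = Σ_{j<N} χ(g)^{−j} (Σ_{s∈S} χ(s)^j) ∏_{p|N} (1 − ζ_p^{−j})`, where the middle factor vanishes
  for `(j, N) = 1` (§2: "`χ'` conjugate to `χ`") and the last for `(j, N) > 1` ("`χ'(β) = 0`").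
* §4 `IsCMTypeWith.isBalanced_posPart_of_oddAnnihilator` — "This can be rewritten in the form `Δ⁻¹ − cΔ⁻¹`": for an
  odd `{0,±1}`-valued annihilator `β`, the set `Δ = {β = 1}` is balanced (and sporadic);
  `IsCMTypeWith.exists_sporadic_iff_exists_oddAnnihilator` = PROPOSITION 1, (2) ⟺ (3);
  `IsCMTypeWith.typeRank_ne_of_oddAnnihilator` (a nonzero odd RATIONAL annihilator already forces degeneracy — the
  "higher powers `Aⁿ`" remark with Lemma 2).
* §5 **LEMMA 3** for the module `N` of odd annihilators of `S − cS`: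
  `IsCMTypeWith.exists_oddAnnihilator_signs_of_oddCharacter` (an odd character vanishing on `S` ⟹ a nonzero odd
  annihilator with coefficients `0, ±1`, namely `whiteFun |G| χ`) and
  `IsCMTypeWith.exists_oddAnnihilator_signs_of_exists_oddAnnihilator` (`N ≠ 0 ⟹ N` has a nonzero element with
  coefficients `0, ±1`).
* §6 **THEOREM 3 (Lenstra), group level**: `IsCMTypeWith.exists_sporadic_of_oddCharacter` (the sporadic set
  `whiteSet |G| χ ∋ 1`, `∌ c`, with `Δ ∩ cΔ = ∅`) and **`IsCMTypeWith.typeRank_ne_iff_exists_sporadic`**: for a CM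
  type `S` of a finite ABELIAN group, `rank(S) ≠ |G|/2 + 1` iff a sporadic subset exists (⟸ for every `G` is the
  tree's `symm_of_isBalanced_of_typeRank_eq`; ⟹ is Lenstra's theorem: compare `typeRank_eq_of_forall_nat_symm`,
  which for a general `G` only produces a balanced non-symmetric MULTISET, i.e. a sporadic cycle on some power
  `Aⁿ`).
* §7 (gen 20 append) **the size of White's set**: `WhiteLenstra.card_whiteSet` / `card_whiteSet_card` /
  `card_whiteSet_card_mul` — `Δ = whiteSet N' χ` (`N'` any non-zero multiple of `N = |χ(G)| = [G : ker χ]`, e.g. `|G|`)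
  is the disjoint union of the fibres `χ⁻¹(z_T)`, `T ⊆ primes(N)` of even size, so `|Δ| = 2^{ω(N)−1}·|ker χ|
  = 2^{ω(N)−1}|G|/N` (read off the proof of Lemma 3; the formula is not printed): the codimension of the sporadic
  class of Theorem 3 is `|Δ|/2`.

The abelian-variety dress (White's Theorem 3 verbatim: for `K` an abelian CM field and `S` primitive, `A` is
nondegenerate iff `Bᵐ(A) ⊗ ℂ = Dᵐ(A) ⊗ ℂ` for all `m`) is `Pohlmann1968/DegenerateCMTypesAbelianFieldSporadicCycles`.
NOT here: Lemma 3 for an arbitrary `G`-submodule of `ℚ[G]⁻` (only the module of annihilators of `S − cS`, the one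
Theorem 3 uses); Theorem 1 / Theorem 4 (the non-abelian counterexample `G = ℤ/2 × ℤ/2 × ℤ/5 × D₅`, pp. 132–142);
Theorem 2 (`M_A` = image of the reflex norm, cited by White to Deligne); Lemma 1 (rank of the dual type) is the
tree's `typeRank_reflexType_eq`, Lemma 2 the tree's `IsCMTypeWith.typeRank_eq_iff_antiSpan_eq`.

## References

* [White1993SporadicCycles] S. P. White, Compositio Math. 88 (1993) 123–142: §1, §4 Lemma 2, Lemma 3, Theorem 3,
  §5 Proposition 1.
* [Kubota1965] T. Kubota, Trans. AMS 118 (1965), §4 Lemma 2 (tree `IsCMTypeWith.typeRank_eq_iff_forall_oddCharacters`).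
* [Gordon1999HodgeAVSurvey] B. B. Gordon, *A survey of the Hodge conjecture for abelian varieties*, 9.2.2 ([B.138]
  White) and §9.3.
* [Hazama2003CyclicCM] F. Hazama, J. Math. Sci. Univ. Tokyo 10 (2003), Rem. 4.10 (Lenstra's theorem quoted).

## Provenance

Cell `pub-hodgecm2` (COR-CM), literature seat `lit-deligne-3` gen 19 (claim WHITE-LENSTRA; count-neutral).
-/

set_option autoImplicit false

noncomputable section

open scoped BigOperators
open Polynomial

namespace Literature.NumberTheory.ComplexMultiplication

namespace WhiteLenstra

/-! ## §1 Roots of unity attached to sets of primes: `z_T = ∏_{p ∈ T} e^{2πi/p}` -/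

section Roots

/-- `ζ_p = e^{2πi/p}`, the standard primitive `p`-th root of unity in `ℂ`. [folklore] -/
def zeta (p : ℕ) : ℂ := Complex.exp (2 * Real.pi * Complex.I / p)

/-- `ζ_p` is a primitive `p`-th root of unity (`p ≠ 0`) — White's `χ(σ^{2m/p})` for `χ(σ)` a primitive `2m`-th
root. [cite: White1993SporadicCycles, §4 Lemma 3 (proof)] -/
theorem isPrimitiveRoot_zeta {p : ℕ} (hp : p ≠ 0) : IsPrimitiveRoot (zeta p) p :=
  Complex.isPrimitiveRoot_exp p hp

/-- `ζ_p ≠ 0`. [folklore] -/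
private theorem zeta_ne_zero (p : ℕ) : zeta p ≠ 0 := Complex.exp_ne_zero _

/-- `ζ_p^k = 1 ⟺ p ∣ k` (`p ≠ 0`): "the order of … `σ^{2m/p}H` is exactly `p`". [cite: White1993SporadicCycles, §4 Lemma 3 (proof)] -/
theorem zeta_pow_eq_one_iff {p : ℕ} (hp : p ≠ 0) (k : ℕ) : zeta p ^ k = 1 ↔ p ∣ k :=
  (isPrimitiveRoot_zeta hp).pow_eq_one_iff_dvd k

/-- `ζ_2 = −1` (White's `σ^m = c`: the factor `p = 2` of `∏_{p | 2m}(1 − σ^{2m/p})` carries the sign).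
[cite: White1993SporadicCycles, §4 Lemma 3 (proof)] -/
theorem zeta_two : zeta 2 = -1 := by
  unfold zeta
  have h : (2 * Real.pi * Complex.I / (2 : ℕ) : ℂ) = Real.pi * Complex.I := by push_cast; ring
  rw [h, Complex.exp_pi_mul_I]

/-- `z_T = ∏_{p ∈ T} ζ_p` — the character value of White's product `σ^{Σ_{p∈T} 2m/p}` (`χ(σ^{2m/p}) = ζ_p`).
[cite: White1993SporadicCycles, §4 Lemma 3 (proof)] -/
def rootProd (T : Finset ℕ) : ℂ := ∏ p ∈ T, zeta p

/-- `z_∅ = 1`. [cite: White1993SporadicCycles, §4 Lemma 3 (proof)] -/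
theorem rootProd_empty : rootProd ∅ = 1 := Finset.prod_empty

/-- `z_{T ∪ {p}} = ζ_p z_T` for `p ∉ T`. [cite: White1993SporadicCycles, §4 Lemma 3 (proof)] -/
theorem rootProd_insert {p : ℕ} {T : Finset ℕ} (h : p ∉ T) : rootProd (insert p T) = zeta p * rootProd T :=
  Finset.prod_insert h

/-- `z_T ≠ 0`. [folklore] -/
private theorem rootProd_ne_zero (T : Finset ℕ) : rootProd T ≠ 0 :=
  Finset.prod_ne_zero_iff.2 fun p _ => zeta_ne_zero p

/-- `z_T^N = 1` when every `p ∈ T` is a non-zero divisor of `N`. [folklore] -/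
private theorem rootProd_pow_eq_one {T : Finset ℕ} {N : ℕ} (hT : ∀ p ∈ T, p ≠ 0 ∧ p ∣ N) : rootProd T ^ N = 1 := by
  unfold rootProd
  rw [← Finset.prod_pow]
  exact Finset.prod_eq_one fun p hp => (zeta_pow_eq_one_iff (hT p hp).1 N).2 (hT p hp).2

/-- `z_T^k = ζ_p^k` when every prime of `T` other than `p` divides `k` and `p ∈ T`; `z_T^k = 1` when moreover
`p ∉ T`. [cite: White1993SporadicCycles, §4 Lemma 3 (proof)] -/
private theorem rootProd_pow_of_dvd {T : Finset ℕ} {p k : ℕ} (hT0 : ∀ q ∈ T, q ≠ 0)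
    (hk : ∀ q ∈ T, q ≠ p → q ∣ k) :
    rootProd T ^ k = if p ∈ T then zeta p ^ k else 1 := by
  classical
  unfold rootProd
  rw [← Finset.prod_pow]
  by_cases hp : p ∈ T
  · rw [if_pos hp, ← Finset.mul_prod_erase T (fun q => zeta q ^ k) hp]
    rw [Finset.prod_eq_one fun q hq => ?_, mul_one]
    have hq' := Finset.mem_erase.1 hq
    exact (zeta_pow_eq_one_iff (hT0 q hq'.2) k).2 (hk q hq'.2 hq'.1)
  · rw [if_neg hp]
    exact Finset.prod_eq_one fun q hq =>
      (zeta_pow_eq_one_iff (hT0 q hq) k).2 (hk q hq fun h => hp (h ▸ hq))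

/-- One inclusion of the injectivity: if `z_T = z_{T'}` for sets of primes then `T ⊆ T'`.
[cite: White1993SporadicCycles, §4 Lemma 3 (proof)] -/
private theorem subset_of_rootProd_eq {T T' : Finset ℕ} (hT : ∀ p ∈ T, p.Prime) (hT' : ∀ p ∈ T', p.Prime)
    (h : rootProd T = rootProd T') : T ⊆ T' := by
  classical
  intro p hp
  by_contra hp'
  -- `k` = the product of all the other primes involved
  set k : ℕ := ∏ q ∈ (T ∪ T').erase p, q with hk
  have hkdvd : ∀ q ∈ T ∪ T', q ≠ p → q ∣ k := fun q hq hqp =>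
    Finset.dvd_prod_of_mem (fun q => q) (Finset.mem_erase.2 ⟨hqp, hq⟩)
  have h1 : rootProd T ^ k = zeta p ^ k := by
    rw [rootProd_pow_of_dvd (fun q hq => (hT q hq).ne_zero)
      (fun q hq hqp => hkdvd q (Finset.mem_union_left _ hq) hqp), if_pos hp]
  have h2 : rootProd T' ^ k = 1 := by
    rw [rootProd_pow_of_dvd (fun q hq => (hT' q hq).ne_zero)
      (fun q hq hqp => hkdvd q (Finset.mem_union_right _ hq) hqp), if_neg hp']
  rw [h, h2] at h1
  -- so `ζ_p^k = 1`, i.e. `p ∣ k`, i.e. `p` divides one of the other primes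
  have hpk : p ∣ k := (zeta_pow_eq_one_iff (hT p hp).ne_zero k).1 h1.symm
  rw [hk, (hT p hp).prime.dvd_finsetProd_iff] at hpk
  obtain ⟨q, hq, hpq⟩ := hpk
  have hq' := Finset.mem_erase.1 hq
  have hqprime : q.Prime := by
    rcases Finset.mem_union.1 hq'.2 with hqT | hqT'
    · exact hT q hqT
    · exact hT' q hqT'
  exact hq'.1 ((Nat.prime_dvd_prime_iff_eq (hT p hp) hqprime).1 hpq).symm

/-- **"The order of a typical product `σ^{2m/p₁}⋯σ^{2m/p_t}H` is exactly `p₁⋯p_t`, different for each product"**: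
`T ↦ z_T = ∏_{p∈T} e^{2πi/p}` is injective on finite sets of primes. [cite: White1993SporadicCycles, §4 Lemma 3 (proof)] -/
theorem rootProd_injective_of_prime {T T' : Finset ℕ} (hT : ∀ p ∈ T, p.Prime) (hT' : ∀ p ∈ T', p.Prime)
    (h : rootProd T = rootProd T') : T = T' :=
  Finset.Subset.antisymm (subset_of_rootProd_eq hT hT' h) (subset_of_rootProd_eq hT' hT h.symm)

end Roots

/-! ## §2 Galois conjugates of a vanishing sum of roots of unity -/

section Conjugates

/-- **"`χ` and `χᵗ` are conjugate ⟺ `(t, 2m) = 1`"**, in the form used: if `N`-th roots of unity `u_i` (`N > 0`)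
satisfy `Σ_i u_i = 0`, then `Σ_i u_iᵗ = 0` for every `t` prime to `N` — the cyclotomic polynomial `Φ_N`, the minimal
polynomial of `ζ = e^{2πi/N}` over `ℚ`, divides `Σ_i X^{e_i}` (`u_i = ζ^{e_i}`), and `ζᵗ` is another root of `Φ_N`.
Applied to `u_s = χ(s)`, `s ∈ S`: an odd character vanishing on `S` vanishes on `S` together with all its
conjugates. [cite: White1993SporadicCycles, §4 Lemma 3 (proof)] -/
theorem sum_pow_eq_zero_of_coprime {ι : Type*} (s : Finset ι) (u : ι → ℂ) {N : ℕ} (hN : 0 < N)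
    (hu : ∀ i ∈ s, u i ^ N = 1) (h0 : ∑ i ∈ s, u i = 0) {t : ℕ} (ht : t.Coprime N) :
    ∑ i ∈ s, u i ^ t = 0 := by
  classical
  haveI : NeZero N := ⟨hN.ne'⟩
  have hζ := isPrimitiveRoot_zeta hN.ne'
  -- exponents: `u i = ζ ^ e i`
  have hex : ∀ i ∈ s, ∃ e : ℕ, zeta N ^ e = u i := fun i hi => by
    obtain ⟨e, -, he⟩ := hζ.eq_pow_of_pow_eq_one (hu i hi)
    exact ⟨e, he⟩
  choose! e he using hex
  -- the polynomial `P = Σ_i X^{e i}` vanishes at `ζ`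
  set P : ℚ[X] := ∑ i ∈ s, X ^ e i with hP
  have haeval : ∀ z : ℂ, aeval z P = ∑ i ∈ s, z ^ e i := fun z => by
    simp only [hP, map_sum, map_pow, aeval_X]
  have h1 : aeval (zeta N) P = 0 := by
    rw [haeval, ← h0]
    exact Finset.sum_congr rfl fun i hi => he i hi
  have hdvd : minpoly ℚ (zeta N) ∣ P := minpoly.dvd ℚ (zeta N) h1
  -- `ζᵗ` is another root of the minimal polynomial `Φ_N`
  have hroot : aeval (zeta N ^ t) (minpoly ℚ (zeta N)) = 0 := by
    rw [← cyclotomic_eq_minpoly_rat hζ hN, aeval_def, ← eval_map, map_cyclotomic, ← IsRoot.def,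
      isRoot_cyclotomic_iff]
    exact hζ.pow_of_coprime t ht
  have h2 := aeval_eq_zero_of_dvd_aeval_eq_zero hdvd hroot
  rw [haeval] at h2
  rw [← h2]
  refine Finset.sum_congr rfl fun i hi => ?_
  rw [← he i hi, pow_right_comm]

/-- **Geometric sums over `μ_N`** (Fourier inversion on the cyclic group of `N`-th roots of unity): for `u^N = 1`,
`Σ_{j<N} u^j = N` if `u = 1` and `0` otherwise. [folklore] -/
private theorem geom_sum_of_pow_eq_one {u : ℂ} {N : ℕ} (hu : u ^ N = 1) :
    ∑ j ∈ Finset.range N, u ^ j = if u = 1 then (N : ℂ) else 0 := by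
  by_cases h1 : u = 1
  · rw [if_pos h1, h1]
    simp
  · rw [if_neg h1]
    have h := geom_sum_mul u N
    rw [hu, sub_self] at h
    exact (mul_eq_zero.1 h).resolve_right (sub_ne_zero.2 h1)

end Conjugates

/-! ## §3 White's `β`, read through the character -/

section Beta

variable {G : Type*} [CommGroup G] [Fintype G] [DecidableEq G]

/-- **White's `β = H · ∏_{p | N}(1 − σ^{N/p})` read through `χ`** (`H = ker χ`, `N = |G/H|`, `χ(σ) = e^{2πi/N}`):
`β(x) = Σ_{T ⊆ primes(N)} (−1)^{|T|} [χ(x) = z_T]`, `z_T = ∏_{p∈T} e^{2πi/p}` — a rational function on `G`, defined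
for every `N` (White's is `N = ord χ`; any `N` with `χ^N = 1` works below). [cite: White1993SporadicCycles, §4 Lemma 3 (proof)] -/
def whiteFun (N : ℕ) (χ : AddChar (Additive G) ℂ) (x : G) : ℚ :=
  ∑ T ∈ N.primeFactors.powerset, if χ (Additive.ofMul x) = rootProd T then (-1 : ℚ) ^ T.card else 0

/-- **White's sporadic subset** `Δ = {x | β(x) = 1}` ("This can be rewritten in the form `Δ⁻¹ − cΔ⁻¹`": `β = 𝟙_Δ −
𝟙_{cΔ}`). [cite: White1993SporadicCycles, §4 Theorem 3 (proof)] -/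
def whiteSet (N : ℕ) (χ : AddChar (Additive G) ℂ) : Finset G :=
  Finset.univ.filter fun x => whiteFun N χ x = 1

omit [Fintype G] [DecidableEq G] in
/-- Members of `primes(N)` and of its subsets are primes. [folklore] -/
private theorem prime_of_mem_of_subset {N : ℕ} {T : Finset ℕ} (hT : T ⊆ N.primeFactors) :
    ∀ p ∈ T, p.Prime := fun _ hp => Nat.prime_of_mem_primeFactors (hT hp)

omit [Fintype G] [DecidableEq G] in
/-- **The value of `β` on the coset `σ^{Σ_{p∈T₀} N/p} H`**: if `χ(x) = z_{T₀}` then `β(x) = (−1)^{|T₀|}` (the other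
products give other cosets). [cite: White1993SporadicCycles, §4 Lemma 3 (proof)] -/
theorem whiteFun_of_eq {N : ℕ} {χ : AddChar (Additive G) ℂ} {x : G} {T₀ : Finset ℕ} (hT₀ : T₀ ⊆ N.primeFactors)
    (hx : χ (Additive.ofMul x) = rootProd T₀) : whiteFun N χ x = (-1 : ℚ) ^ T₀.card := by
  unfold whiteFun
  rw [Finset.sum_eq_single_of_mem T₀ (Finset.mem_powerset.2 hT₀)]
  · rw [if_pos hx]
  · intro T hT hne
    rw [if_neg]
    intro h
    exact hne (rootProd_injective_of_prime (prime_of_mem_of_subset (Finset.mem_powerset.1 hT))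
      (prime_of_mem_of_subset hT₀) (h.symm.trans hx))

omit [Fintype G] [DecidableEq G] in
/-- **`β` vanishes off the cosets `σ^{Σ_{p∈T} N/p} H`**: if `χ(x)` is none of the `z_T` then `β(x) = 0`.
[cite: White1993SporadicCycles, §4 Lemma 3 (proof)] -/
theorem whiteFun_of_forall_ne {N : ℕ} {χ : AddChar (Additive G) ℂ} {x : G}
    (hx : ∀ T ⊆ N.primeFactors, χ (Additive.ofMul x) ≠ rootProd T) : whiteFun N χ x = 0 :=
  Finset.sum_eq_zero fun T hT => if_neg (hx T (Finset.mem_powerset.1 hT))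

omit [Fintype G] [DecidableEq G] in
/-- **"`β` has the appropriate coefficients"**: `β(x) ∈ {0, 1, −1}`. [cite: White1993SporadicCycles, §4 Lemma 3] -/
theorem whiteFun_mem_signs (N : ℕ) (χ : AddChar (Additive G) ℂ) (x : G) :
    whiteFun N χ x = 0 ∨ whiteFun N χ x = 1 ∨ whiteFun N χ x = -1 := by
  by_cases hx : ∃ T ⊆ N.primeFactors, χ (Additive.ofMul x) = rootProd T
  · obtain ⟨T, hT, hxT⟩ := hx
    rw [whiteFun_of_eq hT hxT]
    exact Or.inr (neg_one_pow_eq_or ℚ T.card)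
  · push Not at hx
    exact Or.inl (whiteFun_of_forall_ne hx)

omit [Fintype G] [DecidableEq G] in
/-- **`β(1) = 1`** (the identity lies in `H` itself, the product indexed by `T = ∅`); in particular `β ≠ 0`.
[cite: White1993SporadicCycles, §4 Lemma 3] -/
theorem whiteFun_one (N : ℕ) (χ : AddChar (Additive G) ℂ) : whiteFun N χ 1 = 1 := by
  have h1 : χ (Additive.ofMul (1 : G)) = rootProd ∅ := by
    rw [ofMul_one, AddChar.map_zero_eq_one, rootProd_empty]
  rw [whiteFun_of_eq (Finset.empty_subset _) h1, Finset.card_empty, pow_zero]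

omit [DecidableEq G] in
/-- Membership in White's set: `x ∈ Δ ⟺ β(x) = 1`. [cite: White1993SporadicCycles, §4 Theorem 3 (proof)] -/
theorem mem_whiteSet_iff' {N : ℕ} {χ : AddChar (Additive G) ℂ} {x : G} :
    x ∈ whiteSet N χ ↔ whiteFun N χ x = 1 := by
  simp [whiteSet]

omit [DecidableEq G] in
/-- **`Δ` is the union of the cosets `σ^{Σ_{p∈T} N/p} H` with `|T|` even**: `x ∈ Δ ⟺ χ(x) = z_T` for some
`T ⊆ primes(N)` of even size. [cite: White1993SporadicCycles, §4 Lemma 3 and Theorem 3 (proofs)] -/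
theorem mem_whiteSet_iff {N : ℕ} {χ : AddChar (Additive G) ℂ} {x : G} :
    x ∈ whiteSet N χ ↔ ∃ T ⊆ N.primeFactors, Even T.card ∧ χ (Additive.ofMul x) = rootProd T := by
  rw [mem_whiteSet_iff']
  by_cases hx : ∃ T ⊆ N.primeFactors, χ (Additive.ofMul x) = rootProd T
  · obtain ⟨T, hT, hxT⟩ := hx
    rw [whiteFun_of_eq hT hxT, neg_one_pow_eq_one_iff_even (by norm_num)]
    constructor
    · intro he
      exact ⟨T, hT, he, hxT⟩
    · rintro ⟨T', hT', he', hxT'⟩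
      rwa [rootProd_injective_of_prime (prime_of_mem_of_subset hT) (prime_of_mem_of_subset hT')
        (hxT.symm.trans hxT')]
  · push Not at hx
    rw [whiteFun_of_forall_ne hx]
    simp only [zero_ne_one, false_iff, not_exists, not_and]
    exact fun T hT _ => hx T hT

omit [DecidableEq G] in
/-- `1 ∈ Δ`. [cite: White1993SporadicCycles, §4 Theorem 3 (proof)] -/
theorem one_mem_whiteSet (N : ℕ) (χ : AddChar (Additive G) ℂ) : (1 : G) ∈ whiteSet N χ :=
  mem_whiteSet_iff'.2 (whiteFun_one N χ)

omit [Fintype G] [DecidableEq G] in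
/-- **The reduced form of `β`** (the factor `p = 2` made explicit, `ζ_2 = −1`, `σ^{N/2} = c`):
`β(x) = Σ_{T ⊆ odd primes(N)} (−1)^{|T|} ([χ(x) = z_T] − [χ(x) = −z_T])`, for `N` even.
[cite: White1993SporadicCycles, §4 Lemma 3 (proof)] -/
theorem whiteFun_eq_reduced {N : ℕ} (h2 : 2 ∈ N.primeFactors) (χ : AddChar (Additive G) ℂ) (x : G) :
    whiteFun N χ x = ∑ T ∈ (N.primeFactors.erase 2).powerset,
      ((if χ (Additive.ofMul x) = rootProd T then (-1 : ℚ) ^ T.card else 0) -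
        (if χ (Additive.ofMul x) = -rootProd T then (-1 : ℚ) ^ T.card else 0)) := by
  unfold whiteFun
  conv_lhs => rw [← Finset.insert_erase h2]
  rw [Finset.sum_powerset_insert (Finset.notMem_erase 2 N.primeFactors), ← Finset.sum_add_distrib]
  refine Finset.sum_congr rfl fun T hT => ?_
  have h2T : 2 ∉ T := fun h => Finset.notMem_erase 2 N.primeFactors (Finset.mem_powerset.1 hT h)
  rw [rootProd_insert h2T, zeta_two, neg_one_mul, Finset.card_insert_of_notMem h2T, pow_succ, mul_neg_one,
    sub_eq_add_neg]
  congr 1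
  split_ifs <;> simp

omit [Fintype G] [DecidableEq G] in
/-- **`β ∈ ℚ[G]⁻`: `β(cx) = −β(x)`** for `χ` odd (`χ(c) = −1`) and `N` even. [cite: White1993SporadicCycles, §4 Lemma 3] -/
theorem whiteFun_rho_mul {N : ℕ} (h2 : 2 ∈ N.primeFactors) {χ : AddChar (Additive G) ℂ} {ρ : G}
    (hodd : χ (Additive.ofMul ρ) = -1) (x : G) : whiteFun N χ (ρ * x) = -whiteFun N χ x := by
  have hρx : χ (Additive.ofMul (ρ * x)) = -χ (Additive.ofMul x) := by
    rw [ofMul_mul, AddChar.map_add_eq_mul, hodd, neg_one_mul]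
  rw [whiteFun_eq_reduced h2, whiteFun_eq_reduced h2, ← Finset.sum_neg_distrib]
  refine Finset.sum_congr rfl fun T _ => ?_
  simp_rw [hρx, neg_inj, neg_eq_iff_eq_neg]
  ring

omit [Fintype G] [DecidableEq G] in
/-- **Agreement with the printed `β = H · ∏_{p | N}(1 − σ^{N/p})`.**  If `χ(σ) = e^{2πi/N}` (so `σH` generates
`G/H ≅ ℤ/N`, `H = ker χ`), then `β(x) = Σ_{T ⊆ primes(N)} (−1)^{|T|} [x ∈ σ^{Σ_{p∈T} N/p} H]` — the expansion of
White's product. [cite: White1993SporadicCycles, §4 Lemma 3 (proof)] -/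
theorem whiteFun_eq_printed {N : ℕ} (hN : N ≠ 0) {χ : AddChar (Additive G) ℂ} {σ : G}
    (hσ : χ (Additive.ofMul σ) = zeta N) (x : G) :
    whiteFun N χ x = ∑ T ∈ N.primeFactors.powerset,
      if χ (Additive.ofMul (x * (σ ^ (∑ p ∈ T, N / p))⁻¹)) = 1 then (-1 : ℚ) ^ T.card else 0 := by
  unfold whiteFun
  refine Finset.sum_congr rfl fun T hT => ?_
  have hT' := Finset.mem_powerset.1 hT
  -- `χ(σ^{Σ N/p}) = ∏ ζ_N^{N/p} = ∏ ζ_p = z_T`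
  have hpow : ∀ p ∈ T, zeta N ^ (N / p) = zeta p := by
    intro p hp
    have hpN := Nat.dvd_of_mem_primeFactors (hT' hp)
    have hp0 : p ≠ 0 := (Nat.prime_of_mem_primeFactors (hT' hp)).ne_zero
    unfold zeta
    rw [← Complex.exp_nat_mul]
    congr 1
    have hNp : ((N / p : ℕ) : ℂ) * (p : ℂ) = (N : ℂ) := by exact_mod_cast Nat.div_mul_cancel hpN
    have hN' : (N : ℂ) ≠ 0 := Nat.cast_ne_zero.2 hN
    have hp' : (p : ℂ) ≠ 0 := Nat.cast_ne_zero.2 hp0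
    have hdiv : ((N / p : ℕ) : ℂ) = (N : ℂ) / (p : ℂ) := by rw [eq_div_iff hp']; exact hNp
    rw [hdiv]
    field_simp
  have hχσ : χ (Additive.ofMul (σ ^ (∑ p ∈ T, N / p))) = rootProd T := by
    rw [ofMul_pow, AddChar.map_nsmul_eq_pow, hσ, ← Finset.prod_pow_eq_pow_sum]
    exact Finset.prod_congr rfl hpow
  have key : χ (Additive.ofMul (x * (σ ^ (∑ p ∈ T, N / p))⁻¹)) = 1 ↔ χ (Additive.ofMul x) = rootProd T := by
    rw [ofMul_mul, ofMul_inv, AddChar.map_add_eq_mul, AddChar.map_neg_eq_inv, hχσ,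
      mul_inv_eq_one₀ (rootProd_ne_zero T)]
  by_cases hx : χ (Additive.ofMul x) = rootProd T
  · rw [if_pos hx, if_pos (key.2 hx)]
  · rw [if_neg hx, if_neg (fun h => hx (key.1 h))]

/-- **The product expansion behind `β`**: `Σ_{T ⊆ P} (−1)^{|T|} (z_T^j)⁻¹ = ∏_{p ∈ P} (1 − (ζ_p^j)⁻¹)` — White's
`χ'(β) = ∏_{p|2m} (1 − χ'(σ^{2m/p}))` for `χ' = χ̄ʲ`. [cite: White1993SporadicCycles, §4 Lemma 3 (proof)] -/
theorem sum_neg_one_pow_mul_inv_rootProd_pow (P : Finset ℕ) (j : ℕ) :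
    ∑ T ∈ P.powerset, (-1 : ℂ) ^ T.card * (rootProd T ^ j)⁻¹ = ∏ p ∈ P, (1 - (zeta p ^ j)⁻¹) := by
  have h1 : ∏ p ∈ P, (1 - (zeta p ^ j)⁻¹) = ∏ p ∈ P, (-(zeta p ^ j)⁻¹ + 1) :=
    Finset.prod_congr rfl fun p _ => by ring
  rw [h1, Finset.prod_add]
  refine Finset.sum_congr rfl fun T _ => ?_
  rw [Finset.prod_const_one, mul_one]
  have h2 : ∏ p ∈ T, -(zeta p ^ j)⁻¹ = ∏ p ∈ T, ((-1 : ℂ) * (zeta p ^ j)⁻¹) :=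
    Finset.prod_congr rfl fun p _ => by ring
  rw [h2, Finset.prod_mul_distrib, Finset.prod_const, Finset.prod_inv_distrib, Finset.prod_pow]
  rfl

/-- **"`χ'(β) = 0` for every odd `χ'` not conjugate to `χ`"**: if `j` is NOT prime to `N` then
`∏_{p | N} (1 − (ζ_p^j)⁻¹) = 0` (a prime `p ∣ (j, N)` gives the factor `1 − 1`). [cite: White1993SporadicCycles, §4 Lemma 3 (proof)] -/
theorem prod_one_sub_inv_zeta_pow_eq_zero {N j : ℕ} (hN : N ≠ 0) (hj : ¬j.Coprime N) :
    ∏ p ∈ N.primeFactors, (1 - (zeta p ^ j)⁻¹) = 0 := by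
  obtain ⟨p, hp, hpj, hpN⟩ := Nat.Prime.not_coprime_iff_dvd.1 hj
  refine Finset.prod_eq_zero (Nat.mem_primeFactors.2 ⟨hp, hpN, hN⟩) ?_
  rw [(zeta_pow_eq_one_iff hp.ne_zero j).2 hpj, inv_one, sub_self]

omit [Fintype G] [DecidableEq G] in
/-- `Σ_x Σ_y a c(x) w(y) = a (Σ_x c(x)) (Σ_y w(y))`. [folklore] -/
private theorem sum_sum_mul_mul {α β : Type*} (s₁ : Finset α) (s₂ : Finset β) (a : ℂ) (c : α → ℂ)
    (w : β → ℂ) : ∑ x ∈ s₁, ∑ y ∈ s₂, a * c x * w y = a * (∑ x ∈ s₁, c x) * ∑ y ∈ s₂, w y := by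
  calc ∑ x ∈ s₁, ∑ y ∈ s₂, a * c x * w y = ∑ x ∈ s₁, (a * c x) * ∑ y ∈ s₂, w y :=
        Finset.sum_congr rfl fun x _ => (Finset.mul_sum _ _ _).symm
    _ = (∑ x ∈ s₁, a * c x) * ∑ y ∈ s₂, w y := (Finset.sum_mul _ _ _).symm
    _ = a * (∑ x ∈ s₁, c x) * ∑ y ∈ s₂, w y := by
        congr 1
        exact (Finset.mul_sum _ _ _).symm

/-- Reindexing along the translation `x ↦ g⁻¹x`: `Σ_x [gx ∈ S] F(x) = Σ_{s ∈ S} F(g⁻¹s)`. [folklore] -/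
private theorem sum_ite_mul_mem_eq (Φ : Finset G) (g : G) (F : G → ℂ) :
    ∑ x, (if g * x ∈ Φ then F x else 0) = ∑ s ∈ Φ, F (g⁻¹ * s) := by
  classical
  rw [Fintype.sum_equiv (Equiv.mulLeft g) (fun x => if g * x ∈ Φ then F x else 0)
    (fun y => if y ∈ Φ then F (g⁻¹ * y) else 0) (fun x => by simp)]
  rw [← Finset.sum_filter, Finset.filter_mem_eq_inter, Finset.univ_inter]

omit [Fintype G] in
/-- The translate indicator as a complex number: `[g • x ∈ S]`. [folklore] -/
private theorem translateInd_cast (Φ : Finset G) (g x : G) :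
    ((translateInd (Φ : Set G) g x : ℚ) : ℂ) = if g * x ∈ Φ then 1 else 0 := by
  unfold translateInd
  simp only [smul_eq_mul, Finset.mem_coe]
  split_ifs <;> simp

/-- **The heart of LEMMA 3: `β` annihilates every translate of `S`.**  If `χ(x)^N = 1` for all `x` (`N > 0`) and the
character `χ` VANISHES on `S` (`Σ_{s∈S} χ(s) = 0`), then `Σ_x β(x)·[gx ∈ S] = 0` for every `g ∈ G` — i.e. `β` lies
in White's module `N` of right annihilators of `S − cS` (`sum_mul_antiVec_eq_two_mul`).  Proof (White's, by characters):
`N·[χ(x) = z_T] = Σ_{j<N} (χ(x) z_T⁻¹)^j`, so `N·Σ_x β(x)[gx ∈ S] = Σ_{j<N} χ(g⁻¹)^j (Σ_{s∈S} χ(s)^j)·∏_{p|N}(1 −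
ζ_p^{−j})`; for `(j, N) = 1` the character `χʲ` is conjugate to `χ` and vanishes on `S` (`sum_pow_eq_zero_of_coprime`),
for `(j, N) > 1` the product vanishes (`prod_one_sub_inv_zeta_pow_eq_zero`). [cite: White1993SporadicCycles, §4 Lemma 3 and Theorem 3 (proofs)] -/
theorem sum_whiteFun_mul_translateInd_eq_zero {N : ℕ} (hN : 0 < N) {χ : AddChar (Additive G) ℂ}
    (hχN : ∀ x : G, χ (Additive.ofMul x) ^ N = 1) {Φ : Finset G}
    (hvan : ∑ s ∈ Φ, χ (Additive.ofMul s) = 0) (g : G) :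
    ∑ x, whiteFun N χ x * translateInd (Φ : Set G) g x = 0 := by
  classical
  -- pass to `ℂ` and multiply by `N`
  suffices hC : (N : ℂ) * ∑ x, ((whiteFun N χ x : ℚ) : ℂ) * ((translateInd (Φ : Set G) g x : ℚ) : ℂ) = 0 by
    have hN' : (N : ℂ) ≠ 0 := Nat.cast_ne_zero.2 hN.ne'
    have h0 := (mul_eq_zero.1 hC).resolve_left hN'
    have h1 : ((∑ x, whiteFun N χ x * translateInd (Φ : Set G) g x : ℚ) : ℂ) = 0 := by
      push_cast
      exact h0
    exact_mod_cast h1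
  set P := N.primeFactors with hPdef
  have hz : ∀ T ∈ P.powerset, rootProd T ^ N = 1 := fun T hT =>
    rootProd_pow_eq_one fun p hp => by
      have hp' := Finset.mem_powerset.1 hT hp
      exact ⟨(Nat.prime_of_mem_primeFactors hp').ne_zero, Nat.dvd_of_mem_primeFactors hp'⟩
  -- Fourier inversion: `N·[χ x = z_T] = Σ_{j<N} (χ x)^j (z_T^j)⁻¹`
  have hfour : ∀ x : G, ∀ T ∈ P.powerset,
      (N : ℂ) * (if χ (Additive.ofMul x) = rootProd T then (1 : ℂ) else 0) =
        ∑ j ∈ Finset.range N, χ (Additive.ofMul x) ^ j * (rootProd T ^ j)⁻¹ := by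
    intro x T hT
    have hu : (χ (Additive.ofMul x) * (rootProd T)⁻¹) ^ N = 1 := by
      rw [mul_pow, inv_pow, hχN x, hz T hT, inv_one, mul_one]
    have h := geom_sum_of_pow_eq_one hu
    simp only [mul_inv_eq_one₀ (rootProd_ne_zero T)] at h
    simp_rw [← inv_pow, ← mul_pow]
    rw [h]
    split_ifs <;> simp
  -- expand `N · Σ_x β(x)[gx ∈ S]`
  have hβ : ∀ x : G, ((whiteFun N χ x : ℚ) : ℂ) =
      ∑ T ∈ P.powerset, (-1 : ℂ) ^ T.card * (if χ (Additive.ofMul x) = rootProd T then (1 : ℂ) else 0) := by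
    intro x
    unfold whiteFun
    push_cast
    refine Finset.sum_congr rfl fun T _ => ?_
    split_ifs <;> simp
  have hstep1 : (N : ℂ) * ∑ x, ((whiteFun N χ x : ℚ) : ℂ) * ((translateInd (Φ : Set G) g x : ℚ) : ℂ) =
      ∑ x, (if g * x ∈ Φ then
        (∑ T ∈ P.powerset, (-1 : ℂ) ^ T.card *
          ∑ j ∈ Finset.range N, χ (Additive.ofMul x) ^ j * (rootProd T ^ j)⁻¹) else 0) := by
    rw [Finset.mul_sum]
    refine Finset.sum_congr rfl fun x _ => ?_
    rw [translateInd_cast, hβ]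
    split_ifs with hgx
    · rw [mul_one, Finset.mul_sum]
      refine Finset.sum_congr rfl fun T hT => ?_
      rw [← hfour x T hT]
      ring
    · rw [mul_zero, mul_zero]
  rw [hstep1, sum_ite_mul_mem_eq]
  -- reorder: `Σ_j χ(g⁻¹)^j (Σ_{s∈S} χ(s)^j) (Σ_T (−1)^{|T|} (z_T^j)⁻¹)`
  have hstep2 : ∑ s ∈ Φ, ∑ T ∈ P.powerset, (-1 : ℂ) ^ T.card *
      ∑ j ∈ Finset.range N, χ (Additive.ofMul (g⁻¹ * s)) ^ j * (rootProd T ^ j)⁻¹ =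
      ∑ j ∈ Finset.range N, χ (Additive.ofMul g⁻¹) ^ j * (∑ s ∈ Φ, χ (Additive.ofMul s) ^ j) *
        ∑ T ∈ P.powerset, (-1 : ℂ) ^ T.card * (rootProd T ^ j)⁻¹ := by
    have h1 : ∀ s ∈ Φ, ∀ T ∈ P.powerset, (-1 : ℂ) ^ T.card *
        ∑ j ∈ Finset.range N, χ (Additive.ofMul (g⁻¹ * s)) ^ j * (rootProd T ^ j)⁻¹ =
        ∑ j ∈ Finset.range N, χ (Additive.ofMul g⁻¹) ^ j * χ (Additive.ofMul s) ^ j *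
          ((-1 : ℂ) ^ T.card * (rootProd T ^ j)⁻¹) := by
      intro s _ T _
      rw [Finset.mul_sum]
      refine Finset.sum_congr rfl fun j _ => ?_
      rw [ofMul_mul, AddChar.map_add_eq_mul, mul_pow]
      ring
    calc ∑ s ∈ Φ, ∑ T ∈ P.powerset, (-1 : ℂ) ^ T.card *
          ∑ j ∈ Finset.range N, χ (Additive.ofMul (g⁻¹ * s)) ^ j * (rootProd T ^ j)⁻¹
        = ∑ s ∈ Φ, ∑ T ∈ P.powerset, ∑ j ∈ Finset.range N,
            χ (Additive.ofMul g⁻¹) ^ j * χ (Additive.ofMul s) ^ j * ((-1 : ℂ) ^ T.card * (rootProd T ^ j)⁻¹) :=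
          Finset.sum_congr rfl fun s hs => Finset.sum_congr rfl fun T hT => h1 s hs T hT
      _ = ∑ s ∈ Φ, ∑ j ∈ Finset.range N, ∑ T ∈ P.powerset,
            χ (Additive.ofMul g⁻¹) ^ j * χ (Additive.ofMul s) ^ j * ((-1 : ℂ) ^ T.card * (rootProd T ^ j)⁻¹) :=
          Finset.sum_congr rfl fun s _ => Finset.sum_comm
      _ = ∑ j ∈ Finset.range N, ∑ s ∈ Φ, ∑ T ∈ P.powerset,
            χ (Additive.ofMul g⁻¹) ^ j * χ (Additive.ofMul s) ^ j * ((-1 : ℂ) ^ T.card * (rootProd T ^ j)⁻¹) :=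
          Finset.sum_comm
      _ = ∑ j ∈ Finset.range N, χ (Additive.ofMul g⁻¹) ^ j * (∑ s ∈ Φ, χ (Additive.ofMul s) ^ j) *
            ∑ T ∈ P.powerset, (-1 : ℂ) ^ T.card * (rootProd T ^ j)⁻¹ :=
          Finset.sum_congr rfl fun j _ => sum_sum_mul_mul Φ P.powerset _ _ _
  rw [hstep2]
  refine Finset.sum_eq_zero fun j _ => ?_
  by_cases hj : j.Coprime N
  · -- `χʲ` is conjugate to `χ`: it vanishes on `S`
    rw [sum_pow_eq_zero_of_coprime Φ (fun s => χ (Additive.ofMul s)) hN (fun s _ => hχN s) hvan hj]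
    ring
  · -- `(j, N) > 1`: the product `∏_{p|N}(1 − ζ_p^{−j})` vanishes
    rw [sum_neg_one_pow_mul_inv_rootProd_pow, hPdef, prod_one_sub_inv_zeta_pow_eq_zero hN.ne' hj, mul_zero]

/-- **White's group-ring form of the annihilation condition.**  Against the tree's `±1`-vectors
`antiVec S g = 𝟙_{g⁻¹S} − 𝟙_{g⁻¹cS}` ("`S − cS`"), for a weight `β` of total mass `0` (e.g. any odd `β`):
`Σ_x β(x)(S − cS)_g(x) = 2 Σ_x β(x)[gx ∈ S]`, so "`β` is a right annihilator of `S − cS`" iff `β` annihilates the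
translates of `S`. [cite: White1993SporadicCycles, §4 (p. 130)] -/
theorem sum_mul_antiVec_eq_two_mul {E : Type*} [Fintype E] {G' : Type*} [Group G'] [MulAction G' E] (Φ : Set E)
    {β : E → ℚ} (hβ : ∑ x, β x = 0) (g : G') :
    ∑ x, β x * antiVec Φ g x = 2 * ∑ x, β x * translateInd Φ g x := by
  simp only [antiVec, mul_sub, mul_one, Finset.sum_sub_distrib, hβ, sub_zero]
  rw [Finset.mul_sum]
  exact Finset.sum_congr rfl fun x _ => by ring

end Beta

/-! ## §4 From odd `{0, ±1}`-annihilators to sporadic subsets ("rewritten in the form `Δ⁻¹ − cΔ⁻¹`") -/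

section Sporadic

variable {G : Type*} [CommGroup G] [Fintype G] [DecidableEq G] {ρ : G} {Φ : Finset G}

omit [DecidableEq G] in
/-- An odd weight has total mass zero: `Σ_x β(x) = 0` when `β(cx) = −β(x)`. [folklore] -/
private theorem sum_eq_zero_of_odd {β : G → ℚ} (hodd : ∀ x, β (ρ * x) = -β x) : ∑ x, β x = 0 := by
  have h : ∑ x, β x = ∑ x, β (ρ * x) :=
    (Fintype.sum_equiv (Equiv.mulLeft ρ) (fun x => β (ρ * x)) β fun x => rfl).symm
  simp only [hodd, Finset.sum_neg_distrib] at h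
  linarith

end Sporadic

end WhiteLenstra

namespace IsCMTypeWith

open WhiteLenstra

variable {G : Type*} [CommGroup G] [Fintype G] [DecidableEq G] {ρ : G} {Φ : Finset G}
variable (h : IsCMTypeWith ρ (Φ : Set G))
include h

omit [Fintype G] [DecidableEq G] in
/-- `ρ² = 1` in the multiplicative form. [folklore] -/
private theorem rho_mul_rho_eq : ρ * ρ = 1 := by
  have := h.invol (1 : G)
  simpa [smul_eq_mul] using this

omit [Fintype G] [DecidableEq G] in
/-- `ρ ≠ 1`. [folklore] -/
private theorem rho_ne_one' : ρ ≠ 1 := by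
  intro hρ
  have := h.rho_smul_ne (1 : G)
  rw [hρ, smul_eq_mul, one_mul] at this
  exact this rfl

omit [DecidableEq G] in
/-- `2 ∣ |G|` (`ρ` has order `2`). [folklore] -/
private theorem two_dvd_card_self : 2 ∣ Fintype.card G := by
  have h2 : orderOf ρ = 2 := orderOf_eq_prime (by rw [pow_two, h.rho_mul_rho_eq]) h.rho_ne_one'
  rw [← h2]
  exact orderOf_dvd_card

omit [DecidableEq G] h in
/-- `χ(x)^{|G|} = 1` for every character and every `x`. [folklore] -/
private theorem char_pow_card (χ : AddChar (Additive G) ℂ) (x : G) :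
    χ (Additive.ofMul x) ^ Fintype.card G = 1 := by
  rw [← AddChar.map_nsmul_eq_pow, ← ofMul_pow, pow_card_eq_one, ofMul_one, AddChar.map_zero_eq_one]

omit [DecidableEq G] in
/-- **"This can be rewritten in the form `Δ⁻¹ − cΔ⁻¹`."**  If `β : G → ℚ` takes the values `0, ±1`, is ODD
(`β(cx) = −β(x)`) and ANNIHILATES every translate of `S` (`Σ_x β(x)[gx ∈ S] = 0` for all `g`), then the set
`Δ = {β = 1}` satisfies Pohlmann's condition: `𝟙_Δ = (β + β²)/2` with `β` annihilating and `β²` a union of conjugate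
pairs. [cite: White1993SporadicCycles, §4 Theorem 3 (proof)] -/
theorem isBalanced_posPart_of_oddAnnihilator {β : G → ℚ} (hval : ∀ x, β x = 0 ∨ β x = 1 ∨ β x = -1)
    (hodd : ∀ x, β (ρ * x) = -β x) (hann : ∀ g : G, ∑ x, β x * translateInd (Φ : Set G) g x = 0) :
    IsBalanced G (Φ : Set G) (fun x => if β x = 1 then (1 : ℚ) else 0) := by
  -- `𝟙_Δ = (β + β²)/2`
  have hind : ∀ x, (if β x = 1 then (1 : ℚ) else 0) = (β x + β x ^ 2) / 2 := by
    intro x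
    rcases hval x with hx | hx | hx <;> rw [hx] <;> norm_num
  -- `β²` is `ρ`-symmetric, hence balanced
  have hsq : IsBalanced G (Φ : Set G) (fun x => β x ^ 2) :=
    h.isBalanced_of_symm (f := fun x => β x ^ 2) fun x => by
      simp only [smul_eq_mul, hodd x, neg_sq]
  have hsum : ∑ x, β x = 0 := sum_eq_zero_of_odd hodd
  intro g
  simp_rw [hind]
  have h1 : (2 : ℚ) * ∑ x, (β x + β x ^ 2) / 2 * translateInd (Φ : Set G) g x =
      ∑ x, β x * translateInd (Φ : Set G) g x + ∑ x, β x ^ 2 * translateInd (Φ : Set G) g x := by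
    rw [Finset.mul_sum, ← Finset.sum_add_distrib]
    exact Finset.sum_congr rfl fun x _ => by ring
  have h2 : ∑ x, (β x + β x ^ 2) / 2 = (∑ x, β x) / 2 + (∑ x, β x ^ 2) / 2 := by
    rw [Finset.sum_div, Finset.sum_div, ← Finset.sum_add_distrib]
    exact Finset.sum_congr rfl fun x _ => by ring
  rw [h1, h2, hann g, hsum, zero_add, zero_div, zero_add]
  have h3 := hsq g
  linarith

/-- With `β` as above, `Δ = {β = 1}` is SPORADIC: it is balanced, non-empty, and `Δ ∩ cΔ = ∅` (for `x ∈ Δ`,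
`β(cx) = −1`). [cite: White1993SporadicCycles, §4 Theorem 3 (proof)] -/
theorem exists_sporadic_of_oddAnnihilator {β : G → ℚ} (hval : ∀ x, β x = 0 ∨ β x = 1 ∨ β x = -1)
    (hne : β ≠ 0) (hodd : ∀ x, β (ρ * x) = -β x)
    (hann : ∀ g : G, ∑ x, β x * translateInd (Φ : Set G) g x = 0) :
    ∃ Δ : Finset G, IsBalanced G (Φ : Set G) (fun x => if x ∈ Δ then (1 : ℚ) else 0) ∧ Δ.Nonempty ∧
      ∀ x ∈ Δ, ρ * x ∉ Δ := by
  refine ⟨Finset.univ.filter fun x => β x = 1, ?_, ?_, ?_⟩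
  · have := h.isBalanced_posPart_of_oddAnnihilator hval hodd hann
    simpa only [Finset.mem_filter, Finset.mem_univ, true_and] using this
  · -- some `β x ≠ 0`; then `β = 1` at `x` or at `cx`
    obtain ⟨x, hx⟩ : ∃ x, β x ≠ 0 := by
      by_contra hall
      push Not at hall
      exact hne (funext hall)
    rcases hval x with h0 | h1 | h1
    · exact absurd h0 hx
    · exact ⟨x, by simp [h1]⟩
    · exact ⟨ρ * x, by simp [hodd x, h1]⟩
  · intro x hx
    simp only [Finset.mem_filter, Finset.mem_univ, true_and] at hx ⊢
    rw [hodd x, hx]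
    norm_num

/-- **Conversely, a sporadic subset gives a nonzero odd `{0, ±1}`-annihilator**: `β = 𝟙_Δ − 𝟙_{cΔ}` ("any element
whose coefficients are `0, ±1` can be put in the form `Δ⁻¹ − cΔ⁻¹`"; the annihilation is Pohlmann's condition for
`Δ` and for `cΔ`). [cite: White1993SporadicCycles, §4 (p. 130)] -/
theorem exists_oddAnnihilator_of_sporadic {Δ : Finset G}
    (hbal : IsBalanced G (Φ : Set G) (fun x => if x ∈ Δ then (1 : ℚ) else 0)) {x₀ : G} (hx₀ : x₀ ∈ Δ)
    (hx₀' : ρ * x₀ ∉ Δ) :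
    ∃ β : G → ℚ, (∀ x, β x = 0 ∨ β x = 1 ∨ β x = -1) ∧ β ≠ 0 ∧ (∀ x, β (ρ * x) = -β x) ∧
      ∀ g : G, ∑ x, β x * translateInd (Φ : Set G) g x = 0 := by
  have hρρ : ∀ x : G, ρ * (ρ * x) = x := fun x => by rw [← mul_assoc, h.rho_mul_rho_eq, one_mul]
  refine ⟨fun x => (if x ∈ Δ then (1 : ℚ) else 0) - (if ρ * x ∈ Δ then (1 : ℚ) else 0), ?_, ?_, ?_, ?_⟩
  · intro x
    by_cases h1 : x ∈ Δ <;> by_cases h2 : ρ * x ∈ Δ <;> simp [h1, h2]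
  · intro hz
    have := congrFun hz x₀
    simp [hx₀, hx₀'] at this
  · intro x
    simp only [hρρ]
    ring
  · intro g
    -- `Σ 𝟙_Δ [g x ∈ S] = |Δ|/2` and `Σ 𝟙_{cΔ}[gx ∈ S] = Σ_Δ (1 − [gx ∈ S]) = |Δ|/2`
    have hb := hbal g
    have hb' := (h.isBalanced_comp_rho hbal) g
    simp only [smul_eq_mul] at hb'
    have hre : ∑ x, (if ρ * x ∈ Δ then (1 : ℚ) else 0) = ∑ x, (if x ∈ Δ then (1 : ℚ) else 0) :=
      Fintype.sum_equiv (Equiv.mulLeft ρ) _ _ fun x => rfl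
    simp only [sub_mul, Finset.sum_sub_distrib]
    linarith

/-- **PROPOSITION 1, (2) ⟺ (3), at group level**: a SPORADIC subset exists (`𝟙_Δ` balanced, some `x ∈ Δ` with
`cx ∉ Δ`) iff there is a nonzero ODD weight with coefficients `0, ±1` annihilating all translates of `S` ("There
exists a sporadic `Δ`" ⟺ "There exists (nonzero) `β` … whose coefficients are `±1` or `0` such that `α · β = 0`").
[cite: White1993SporadicCycles, §5 Proposition 1] -/
theorem exists_sporadic_iff_exists_oddAnnihilator :
    (∃ Δ : Finset G, IsBalanced G (Φ : Set G) (fun x => if x ∈ Δ then (1 : ℚ) else 0) ∧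
        ∃ x ∈ Δ, ρ * x ∉ Δ) ↔
      ∃ β : G → ℚ, (∀ x, β x = 0 ∨ β x = 1 ∨ β x = -1) ∧ β ≠ 0 ∧ (∀ x, β (ρ * x) = -β x) ∧
        ∀ g : G, ∑ x, β x * translateInd (Φ : Set G) g x = 0 := by
  constructor
  · rintro ⟨Δ, hbal, x₀, hx₀, hx₀'⟩
    exact h.exists_oddAnnihilator_of_sporadic hbal hx₀ hx₀'
  · rintro ⟨β, hval, hne, hodd, hann⟩
    obtain ⟨Δ, hbal, ⟨x, hx⟩, hsp⟩ := h.exists_sporadic_of_oddAnnihilator hval hne hodd hann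
    exact ⟨Δ, hbal, x, hx, hsp x hx⟩

omit [DecidableEq G] in
/-- **A nonzero odd RATIONAL annihilator already forces degeneracy** (White p. 130: a right annihilator of `S − cS`
with coefficients `0, ±1, …, ±n` is a sporadic cycle on `Aⁿ`; with LEMMA 2, `S − cS` does not generate `ℚ[G]⁻`):
such a `β` is balanced and odd, while on a nondegenerate type every balanced weight is `c`-symmetric
(`symm_of_isBalanced_of_typeRank_eq`). [cite: White1993SporadicCycles, §4 Lemma 2 and p. 130] -/
theorem typeRank_ne_of_oddAnnihilator {β : G → ℚ} (hne : β ≠ 0) (hodd : ∀ x, β (ρ * x) = -β x)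
    (hann : ∀ g : G, ∑ x, β x * translateInd (Φ : Set G) g x = 0) :
    typeRank G (Φ : Set G) ≠ Fintype.card G / 2 + 1 := by
  intro hrank
  have hbal : IsBalanced G (Φ : Set G) β := fun g => by
    rw [hann g, sum_eq_zero_of_odd hodd, mul_zero]
  apply hne
  funext x
  have hs := h.symm_of_isBalanced_of_typeRank_eq hrank hbal x
  rw [smul_eq_mul, hodd x] at hs
  have : β x = 0 := by linarith
  simpa using this

/-! ## §5 LEMMA 3 for the module of odd annihilators of `S − cS` -/

/-- **White's `β` for a vanishing odd character is a nonzero odd `{0,±1}`-annihilator** (`N = |G|`): values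
`0, ±1`, `β(1) = 1`, `β(cx) = −β(x)`, `Σ_x β(x)[gx ∈ S] = 0`. [cite: White1993SporadicCycles, §4 Lemma 3] -/
theorem whiteFun_oddAnnihilator {χ : AddChar (Additive G) ℂ} (hodd : χ (Additive.ofMul ρ) = -1)
    (hvan : ∑ s ∈ Φ, χ (Additive.ofMul s) = 0) :
    (∀ x, whiteFun (Fintype.card G) χ x = 0 ∨ whiteFun (Fintype.card G) χ x = 1 ∨
        whiteFun (Fintype.card G) χ x = -1) ∧
      whiteFun (Fintype.card G) χ 1 = 1 ∧
      (∀ x, whiteFun (Fintype.card G) χ (ρ * x) = -whiteFun (Fintype.card G) χ x) ∧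
      ∀ g : G, ∑ x, whiteFun (Fintype.card G) χ x * translateInd (Φ : Set G) g x = 0 := by
  have h2 : 2 ∈ (Fintype.card G).primeFactors :=
    Nat.mem_primeFactors.2 ⟨Nat.prime_two, h.two_dvd_card_self, Fintype.card_ne_zero⟩
  exact ⟨whiteFun_mem_signs _ χ, whiteFun_one _ χ, whiteFun_rho_mul h2 hodd,
    sum_whiteFun_mul_translateInd_eq_zero Fintype.card_pos (char_pow_card χ) hvan⟩

/-- **LEMMA 3, the instance used by THEOREM 3: an odd character vanishing on `S` yields a nonzero element of the
annihilator module `N ⊆ ℚ[G]⁻` with coefficients `0, ±1`.** [cite: White1993SporadicCycles, §4 Lemma 3] -/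
theorem exists_oddAnnihilator_signs_of_oddCharacter {χ : AddChar (Additive G) ℂ}
    (hodd : χ (Additive.ofMul ρ) = -1) (hvan : ∑ s ∈ Φ, χ (Additive.ofMul s) = 0) :
    ∃ β : G → ℚ, (∀ x, β x = 0 ∨ β x = 1 ∨ β x = -1) ∧ β ≠ 0 ∧ (∀ x, β (ρ * x) = -β x) ∧
      ∀ g : G, ∑ x, β x * translateInd (Φ : Set G) g x = 0 := by
  obtain ⟨hval, h1, hoddβ, hann⟩ := h.whiteFun_oddAnnihilator hodd hvan
  refine ⟨whiteFun (Fintype.card G) χ, hval, fun hz => ?_, hoddβ, hann⟩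
  have := congrFun hz 1
  rw [h1] at this
  exact one_ne_zero this

/-- **LEMMA 3 for `N = {odd annihilators of S − cS}`: if `N ≠ 0` then `N` has a nonzero element whose
coefficients are `0, ±1`.**  (`N ≠ 0 ⟹` degenerate (`typeRank_ne_of_oddAnnihilator`) `⟹` an odd character
vanishes on `S` (Kubota) `⟹` White's `β`.) [cite: White1993SporadicCycles, §4 Lemma 3] [cite: Kubota1965, §4 Lemma 2] -/
theorem exists_oddAnnihilator_signs_of_exists_oddAnnihilator
    (hN : ∃ β : G → ℚ, β ≠ 0 ∧ (∀ x, β (ρ * x) = -β x) ∧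
      ∀ g : G, ∑ x, β x * translateInd (Φ : Set G) g x = 0) :
    ∃ β : G → ℚ, (∀ x, β x = 0 ∨ β x = 1 ∨ β x = -1) ∧ β ≠ 0 ∧ (∀ x, β (ρ * x) = -β x) ∧
      ∀ g : G, ∑ x, β x * translateInd (Φ : Set G) g x = 0 := by
  obtain ⟨β, hne, hodd, hann⟩ := hN
  have hdeg := h.typeRank_ne_of_oddAnnihilator hne hodd hann
  rw [ne_eq, h.typeRank_eq_iff_forall_oddCharacters] at hdeg
  push Not at hdeg
  obtain ⟨χ, hχodd, hχvan⟩ := hdeg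
  exact h.exists_oddAnnihilator_signs_of_oddCharacter hχodd hχvan

/-! ## §6 THEOREM 3 (Lenstra), group level -/

/-- **White's set is balanced**: for an odd character `χ` vanishing on the CM type `S` of the abelian group `G`,
`Δ = whiteSet |G| χ` satisfies Pohlmann's condition `|gΔ ∩ S| = |gΔ ∩ cS|` for every `g`.
[cite: White1993SporadicCycles, §4 Lemma 3 and Theorem 3] -/
theorem isBalanced_whiteSet {χ : AddChar (Additive G) ℂ} (hodd : χ (Additive.ofMul ρ) = -1)
    (hvan : ∑ s ∈ Φ, χ (Additive.ofMul s) = 0) :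
    IsBalanced G (Φ : Set G) (fun x => if x ∈ whiteSet (Fintype.card G) χ then (1 : ℚ) else 0) := by
  obtain ⟨hval, -, hoddβ, hann⟩ := h.whiteFun_oddAnnihilator hodd hvan
  have := h.isBalanced_posPart_of_oddAnnihilator hval hoddβ hann
  simpa only [mem_whiteSet_iff'] using this

omit [DecidableEq G] in
/-- **White's set meets no conjugate pair**: `x ∈ Δ ⟹ cx ∉ Δ` (`β(cx) = −1`); in particular `1 ∈ Δ`, `c ∉ Δ`.
[cite: White1993SporadicCycles, §4 Theorem 3 (proof)] -/
theorem rho_mul_notMem_whiteSet {χ : AddChar (Additive G) ℂ} (hodd : χ (Additive.ofMul ρ) = -1) {x : G}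
    (hx : x ∈ whiteSet (Fintype.card G) χ) : ρ * x ∉ whiteSet (Fintype.card G) χ := by
  classical
  have h2 : 2 ∈ (Fintype.card G).primeFactors :=
    Nat.mem_primeFactors.2 ⟨Nat.prime_two, h.two_dvd_card_self, Fintype.card_ne_zero⟩
  rw [mem_whiteSet_iff'] at hx ⊢
  rw [whiteFun_rho_mul h2 hodd, hx]
  norm_num

/-- **THEOREM 3 (Lenstra), constructive group-level form.**  For a CM type `S` of a finite ABELIAN group `G` and
an ODD character `χ` VANISHING on `S`, White's set `Δ` is SPORADIC: `𝟙_Δ` satisfies Pohlmann's condition, `1 ∈ Δ`,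
and `Δ ∩ cΔ = ∅` — "there exists an element in `N` whose coefficients are `0, ±1` … which gives us a line `Δ`
containing a sporadic cycle on `A`". [cite: White1993SporadicCycles, §4 Theorem 3] -/
theorem exists_sporadic_of_oddCharacter (χ : AddChar (Additive G) ℂ) (hodd : χ (Additive.ofMul ρ) = -1)
    (hvan : ∑ s ∈ Φ, χ (Additive.ofMul s) = 0) :
    ∃ Δ : Finset G, IsBalanced G (Φ : Set G) (fun x => if x ∈ Δ then (1 : ℚ) else 0) ∧ (1 : G) ∈ Δ ∧
      ∀ x ∈ Δ, ρ * x ∉ Δ :=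
  ⟨whiteSet (Fintype.card G) χ, h.isBalanced_whiteSet hodd hvan, one_mem_whiteSet _ χ,
    fun _ hx => h.rho_mul_notMem_whiteSet hodd hx⟩

/-- **THEOREM 3 (Lenstra) ⟺, group level: for a CM type of a finite ABELIAN group, DEGENERATE ⟺ A SPORADIC SUBSET
EXISTS** — `rank(S) ≠ |G|/2 + 1` iff some `Δ ⊆ G` has `𝟙_Δ` balanced and is not a union of conjugate pairs
("`rank(M) = dim(A) + 1` if and only if the ring of Hodge cycles on `A` is generated by classes of images of
divisors", read through Pohlmann's criterion).  ⟹: Kubota gives an odd character vanishing on `S`, and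
`exists_sporadic_of_oddCharacter`; ⟸ (any `G`): `symm_of_isBalanced_of_typeRank_eq`.
[cite: White1993SporadicCycles, §4 Theorem 3] [cite: Kubota1965, §4 Lemma 2] -/
theorem typeRank_ne_iff_exists_sporadic :
    typeRank G (Φ : Set G) ≠ Fintype.card G / 2 + 1 ↔
      ∃ Δ : Finset G, IsBalanced G (Φ : Set G) (fun x => if x ∈ Δ then (1 : ℚ) else 0) ∧
        ∃ x ∈ Δ, ρ * x ∉ Δ := by
  constructor
  · intro hne
    rw [ne_eq, h.typeRank_eq_iff_forall_oddCharacters] at hne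
    push Not at hne
    obtain ⟨χ, hodd, hvan⟩ := hne
    obtain ⟨Δ, hbal, h1, hsp⟩ := h.exists_sporadic_of_oddCharacter χ hodd hvan
    exact ⟨Δ, hbal, 1, h1, hsp 1 h1⟩
  · rintro ⟨Δ, hbal, x, hx, hx'⟩ hrank
    have hs := h.symm_of_isBalanced_of_typeRank_eq hrank hbal x
    simp only [smul_eq_mul, if_pos hx, if_neg hx'] at hs
    exact zero_ne_one hs

/-- **The five equivalent forms of degeneracy for an abelian `G`** (White §4 with Kubota): (1) `rank(S) ≠ |G|/2 + 1`
⟺ (2) an odd character vanishes on `S` ⟺ (3) a nonzero odd rational annihilator of `S − cS` exists (a sporadic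
cycle on some `Aⁿ`) ⟺ (4) one with coefficients `0, ±1` exists ⟺ (5) a sporadic subset exists (a sporadic cycle
on `A`).  Here: (3) ⟺ (1). [cite: White1993SporadicCycles, §4 Lemma 2, Lemma 3, Theorem 3] -/
theorem typeRank_ne_iff_exists_oddAnnihilator :
    typeRank G (Φ : Set G) ≠ Fintype.card G / 2 + 1 ↔
      ∃ β : G → ℚ, β ≠ 0 ∧ (∀ x, β (ρ * x) = -β x) ∧
        ∀ g : G, ∑ x, β x * translateInd (Φ : Set G) g x = 0 := by
  constructor
  · intro hne
    obtain ⟨Δ, hbal, x, hx, hx'⟩ := h.typeRank_ne_iff_exists_sporadic.1 hne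
    obtain ⟨β, -, hne, hodd, hann⟩ := h.exists_oddAnnihilator_of_sporadic hbal hx hx'
    exact ⟨β, hne, hodd, hann⟩
  · rintro ⟨β, hne, hodd, hann⟩
    exact h.typeRank_ne_of_oddAnnihilator hne hodd hann

end IsCMTypeWith

/-! ## §7 The size of White's set: `|Δ| = 2^{ω(N)−1}·|H|` for `H = ker χ`, `N = [G : H]`

White's `β = H·∏_{p | N}(1 − σ^{N/p})` (`σH` a generator of the cyclic group `G/H`, `N = |G/H|`) expands as
`Σ_{T ⊆ primes(N)} (−1)^{|T|} σ^{Σ_{p∈T} N/p} H`, and `Δ = {β = 1}` is the union of the cosets `σ^{Σ_{p∈T} N/p} H` with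
`|T|` even; read through `χ` (`χ(σ) = e^{2πi/N}`, `χ(G) = μ_N`) these are the fibres `χ⁻¹(z_T)`, `T ⊆ primes(N)`, and
a product `z_T` involving a prime `p ∤ N` is not a value of `χ`.  Hence `|Δ| = 2^{ω(N)−1}·|H|`, `ω(N)` the number of
prime divisors of `N` — the size (twice the codimension of the sporadic class of `exists_sporadic_of_oddCharacter`,
which uses `whiteSet |G| χ ⊇` the same cosets) is read off White's description; it is not printed as a formula. -/

namespace WhiteLenstra

section Count

variable {G : Type*} [CommGroup G] [Fintype G] [DecidableEq G]

omit [DecidableEq G] in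
/-- `χ(x)^{|G|} = 1`. [folklore] -/
private theorem char_pow_card_eq_one' (χ : AddChar (Additive G) ℂ) (x : G) :
    χ (Additive.ofMul x) ^ Fintype.card G = 1 := by
  rw [← AddChar.map_nsmul_eq_pow, ← ofMul_pow, pow_card_eq_one, ofMul_one, AddChar.map_zero_eq_one]

omit [DecidableEq G] in
/-- Character values are non-zero. [folklore] -/
private theorem char_ne_zero (χ : AddChar (Additive G) ℂ) (x : G) : χ (Additive.ofMul x) ≠ 0 := by
  intro h0
  have h1 := char_pow_card_eq_one' χ x
  rw [h0, zero_pow Fintype.card_ne_zero] at h1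
  exact zero_ne_one h1

/-- **The fibres of `χ` are cosets of `H = ker χ`**: if `χ(x₀) = z` then `|{x | χ(x) = z}| = |H|` (translation by
`x₀`). [folklore] -/
private theorem card_filter_char_eq (χ : AddChar (Additive G) ℂ) {z : ℂ} {x₀ : G}
    (hx₀ : χ (Additive.ofMul x₀) = z) :
    (Finset.univ.filter fun x : G => χ (Additive.ofMul x) = z).card =
      (Finset.univ.filter fun x : G => χ (Additive.ofMul x) = 1).card := by
  have hz : z ≠ 0 := fun h0 => char_ne_zero χ x₀ (hx₀.trans h0)
  have hset : (Finset.univ.filter fun x : G => χ (Additive.ofMul x) = z) =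
      (Finset.univ.filter fun x : G => χ (Additive.ofMul x) = 1).image (x₀ * ·) := by
    ext y
    simp only [Finset.mem_filter, Finset.mem_univ, true_and, Finset.mem_image]
    constructor
    · intro hy
      refine ⟨x₀⁻¹ * y, ?_, by rw [mul_inv_cancel_left]⟩
      have hmul : χ (Additive.ofMul x₀) * χ (Additive.ofMul (x₀⁻¹ * y)) = χ (Additive.ofMul y) := by
        rw [← AddChar.map_add_eq_mul, ← ofMul_mul, mul_inv_cancel_left]
      rw [hx₀, hy] at hmul
      exact (mul_right_inj' hz).1 (hmul.trans (mul_one z).symm)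
    · rintro ⟨x, hx, rfl⟩
      rw [ofMul_mul, AddChar.map_add_eq_mul, hx₀, hx, mul_one]
  rw [hset, Finset.card_image_of_injective _ (mul_right_injective x₀)]

/-- **`|G| = |χ(G)|·|H|`** (the fibres of `χ` over its `|χ(G)|` values all have `|H|` elements). [folklore] -/
private theorem card_image_mul_card_ker (χ : AddChar (Additive G) ℂ) :
    (Finset.univ.image fun x : G => χ (Additive.ofMul x)).card *
        (Finset.univ.filter fun x : G => χ (Additive.ofMul x) = 1).card = Fintype.card G := by
  have hfib := Finset.card_eq_sum_card_fiberwise (s := (Finset.univ : Finset G))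
    (t := Finset.univ.image fun x : G => χ (Additive.ofMul x)) (f := fun x : G => χ (Additive.ofMul x))
    fun x hx => Finset.mem_image_of_mem _ (Finset.mem_coe.1 hx)
  rw [Finset.sum_const_nat fun z hz => ?_] at hfib
  · rw [← Finset.card_univ, hfib]
  · obtain ⟨x₀, -, hx₀⟩ := Finset.mem_image.1 hz
    exact card_filter_char_eq χ hx₀

omit [DecidableEq G] in
/-- **`z^{|χ(G)|} = 1` for `z ∈ χ(G)`**: multiplication by `z = χ(x₀)` permutes the finite set `χ(G)`, so
`∏_{w ∈ χ(G)} w = z^{|χ(G)|} ∏_{w ∈ χ(G)} w`. [folklore] -/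
private theorem pow_card_image_eq_one (χ : AddChar (Additive G) ℂ) {z : ℂ}
    (hz : z ∈ Finset.univ.image fun x : G => χ (Additive.ofMul x)) :
    z ^ (Finset.univ.image fun x : G => χ (Additive.ofMul x)).card = 1 := by
  set im := Finset.univ.image fun x : G => χ (Additive.ofMul x) with him
  obtain ⟨x₀, -, rfl⟩ := Finset.mem_image.1 hz
  have hz0 : χ (Additive.ofMul x₀) ≠ 0 := char_ne_zero χ x₀
  have hmaps : im.image (χ (Additive.ofMul x₀) * ·) = im := by
    apply Finset.eq_of_subset_of_card_le
    · intro w hw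
      obtain ⟨w', hw', rfl⟩ := Finset.mem_image.1 hw
      obtain ⟨y, -, rfl⟩ := Finset.mem_image.1 hw'
      exact Finset.mem_image.2 ⟨x₀ * y, Finset.mem_univ _, by rw [ofMul_mul, AddChar.map_add_eq_mul]⟩
    · rw [Finset.card_image_of_injective _ (mul_right_injective₀ hz0)]
  have hprod : ∏ w ∈ im, w = χ (Additive.ofMul x₀) ^ im.card * ∏ w ∈ im, w := by
    conv_lhs => rw [← hmaps, Finset.prod_image fun a _ b _ hab => mul_right_injective₀ hz0 hab]
    rw [Finset.prod_mul_distrib, Finset.prod_const]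
  have hne : ∏ w ∈ im, w ≠ 0 := Finset.prod_ne_zero_iff.2 fun w hw => by
    obtain ⟨y, -, rfl⟩ := Finset.mem_image.1 hw
    exact char_ne_zero χ y
  exact mul_right_cancel₀ hne ((one_mul _).trans hprod).symm

omit [DecidableEq G] in
/-- **`χ(G) = μ_N`, `N = |χ(G)|`**: `z ∈ χ(G) ⟺ z^N = 1` (`χ(G) ⊆ μ_N` and both have `N` elements). [folklore] -/
private theorem mem_image_iff_pow_eq_one (χ : AddChar (Additive G) ℂ) (z : ℂ) :
    (z ∈ Finset.univ.image fun x : G => χ (Additive.ofMul x)) ↔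
      z ^ (Finset.univ.image fun x : G => χ (Additive.ofMul x)).card = 1 := by
  set im := Finset.univ.image fun x : G => χ (Additive.ofMul x) with him
  have hpos : 0 < im.card :=
    Finset.card_pos.2 ⟨1, Finset.mem_image.2 ⟨1, Finset.mem_univ _, by rw [ofMul_one, AddChar.map_zero_eq_one]⟩⟩
  have hsub : im ⊆ Polynomial.nthRootsFinset im.card (1 : ℂ) := fun w hw =>
    (Polynomial.mem_nthRootsFinset hpos 1).2 (pow_card_image_eq_one χ hw)
  have heq : im = Polynomial.nthRootsFinset im.card (1 : ℂ) :=
    Finset.eq_of_subset_of_card_le hsub (by rw [(isPrimitiveRoot_zeta hpos.ne').card_nthRootsFinset])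
  refine ⟨fun hz => pow_card_image_eq_one χ hz, fun hz => ?_⟩
  rw [heq]
  exact (Polynomial.mem_nthRootsFinset hpos 1).2 hz

/-- **Orders of the products `z_T`**: for a set `T` of primes, `z_T^N = 1 ⟺` every `p ∈ T` divides `N`
("the order of a typical product … is exactly `p₁⋯p_t`"). [cite: White1993SporadicCycles, §4 Lemma 3 (proof)] -/
private theorem rootProd_pow_eq_one_iff {T : Finset ℕ} (hT : ∀ p ∈ T, p.Prime) (N : ℕ) :
    rootProd T ^ N = 1 ↔ ∀ p ∈ T, p ∣ N := by
  classical
  refine ⟨fun h p hp => ?_, fun h => rootProd_pow_eq_one fun p hp => ⟨(hT p hp).ne_zero, h p hp⟩⟩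
  by_contra hpN
  -- `k = N · (the other primes of T)`: `z_T^k = ζ_p^k` and `z_T^k = 1`, so `p ∣ k`
  set k : ℕ := N * ∏ q ∈ T.erase p, q with hk
  have hkdvd : ∀ q ∈ T, q ≠ p → q ∣ k := fun q hq hqp =>
    Dvd.dvd.mul_left (Finset.dvd_prod_of_mem (fun q => q) (Finset.mem_erase.2 ⟨hqp, hq⟩)) N
  have h1 : rootProd T ^ k = zeta p ^ k := by
    rw [rootProd_pow_of_dvd (fun q hq => (hT q hq).ne_zero) hkdvd, if_pos hp]
  have h2 : rootProd T ^ k = 1 := by rw [hk, pow_mul, h, one_pow]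
  have hpk : p ∣ k := (zeta_pow_eq_one_iff (hT p hp).ne_zero k).1 (h1.symm.trans h2)
  rw [hk] at hpk
  rcases (Nat.Prime.dvd_mul (hT p hp)).1 hpk with hpN' | hpk'
  · exact hpN hpN'
  · rw [(hT p hp).prime.dvd_finsetProd_iff] at hpk'
    obtain ⟨q, hq, hpq⟩ := hpk'
    have hq' := Finset.mem_erase.1 hq
    exact hq'.1 ((Nat.prime_dvd_prime_iff_eq (hT p hp) (hT q hq'.2)).1 hpq).symm

/-- `#{T ⊆ S : |T| even} = 2^{|S| − 1}` for `S ≠ ∅` (and `= 1 = 2^{0−1}` in `ℕ` for `S = ∅`): the even and the odd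
subsets are equinumerous, `Σ_{T ⊆ S} (−1)^{|T|} = 0`. [folklore] -/
private theorem card_powerset_filter_even (S : Finset ℕ) :
    (S.powerset.filter fun T => Even T.card).card = 2 ^ (S.card - 1) := by
  rcases S.eq_empty_or_nonempty with rfl | hS
  · rfl
  · have hsum := Finset.sum_powerset_neg_one_pow_card_of_nonempty hS
    have htot : (S.powerset.filter fun T => Even T.card).card +
        (S.powerset.filter fun T => ¬Even T.card).card = 2 ^ S.card := by
      rw [Finset.card_filter_add_card_filter_not, Finset.card_powerset]
    rw [← Finset.sum_filter_add_sum_filter_not S.powerset (fun T => Even T.card),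
      Finset.sum_congr rfl (g := fun _ => (1 : ℤ)) (fun T hT => (Finset.mem_filter.1 hT).2.neg_one_pow),
      Finset.sum_congr rfl (g := fun _ => (-1 : ℤ))
        (fun T hT => (Nat.not_even_iff_odd.1 (Finset.mem_filter.1 hT).2).neg_one_pow)] at hsum
    simp only [Finset.sum_const, nsmul_eq_mul, mul_one, mul_neg] at hsum
    have h2 : 2 ^ S.card = 2 * 2 ^ (S.card - 1) := by
      rw [← pow_succ', Nat.sub_add_cancel (Finset.card_pos.2 hS)]
    omega

/-- **The size of White's set.**  For a character `χ` of the finite abelian group `G` with kernel `H = {χ = 1}` and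
`N = |χ(G)| = [G : H]` values, and any `N' ≠ 0` divisible by `N` (White: `N' = N = |G/H|`; the tree's
`exists_sporadic_of_oddCharacter` takes `N' = |G|`): `Δ = whiteSet N' χ` is the disjoint union of the `|H|`-element
fibres `χ⁻¹(z_T)` over the subsets `T ⊆ primes(N)` of even size, so **`|Δ| = 2^{ω(N) − 1}·|H|`** (`ω(N) = |primes(N)|`;
`|Δ| = |G|` for `N = 1`).  Read off the proof of Lemma 3 / Theorem 3 (`β = Σ_T (−1)^{|T|} σ^{Σ_{p∈T} N/p} H`,
`Δ = {β = 1}`); the formula itself is not printed. [cite: White1993SporadicCycles, §4 Lemma 3 and Theorem 3 (proofs)] -/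
theorem card_whiteSet (χ : AddChar (Additive G) ℂ) {N' : ℕ} (hN' : N' ≠ 0)
    (hdvd : (Finset.univ.image fun x : G => χ (Additive.ofMul x)).card ∣ N') :
    (whiteSet N' χ).card =
      2 ^ ((Finset.univ.image fun x : G => χ (Additive.ofMul x)).card.primeFactors.card - 1) *
        (Finset.univ.filter fun x : G => χ (Additive.ofMul x) = 1).card := by
  classical
  set im := Finset.univ.image fun x : G => χ (Additive.ofMul x) with him
  have hdpos : 0 < im.card :=
    Finset.card_pos.2 ⟨1, Finset.mem_image.2 ⟨1, Finset.mem_univ _, by rw [ofMul_one, AddChar.map_zero_eq_one]⟩⟩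
  have hprime : ∀ {T : Finset ℕ}, T ⊆ im.card.primeFactors → ∀ p ∈ T, p.Prime := fun hT p hp =>
    Nat.prime_of_mem_primeFactors (hT hp)
  -- Step 1: `Δ = ⋃_{T ⊆ primes(N), |T| even} χ⁻¹(z_T)`
  have hΔ : whiteSet N' χ = (im.card.primeFactors.powerset.filter fun T => Even T.card).biUnion
      fun T => Finset.univ.filter fun x : G => χ (Additive.ofMul x) = rootProd T := by
    ext x
    rw [mem_whiteSet_iff, Finset.mem_biUnion]
    constructor
    · rintro ⟨T, hT, heven, hx⟩
      have hTp : ∀ p ∈ T, p.Prime := fun p hp => Nat.prime_of_mem_primeFactors (hT hp)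
      have hzT : rootProd T ^ im.card = 1 :=
        (mem_image_iff_pow_eq_one χ _).1 (Finset.mem_image.2 ⟨x, Finset.mem_univ _, hx⟩)
      refine ⟨T, Finset.mem_filter.2 ⟨Finset.mem_powerset.2 fun p hp => ?_, heven⟩,
        Finset.mem_filter.2 ⟨Finset.mem_univ _, hx⟩⟩
      exact Nat.mem_primeFactors.2 ⟨hTp p hp, (rootProd_pow_eq_one_iff hTp _).1 hzT p hp, hdpos.ne'⟩
    · rintro ⟨T, hT, hx⟩
      obtain ⟨hTd, heven⟩ := Finset.mem_filter.1 hT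
      exact ⟨T, fun p hp => Nat.primeFactors_mono hdvd hN' (Finset.mem_powerset.1 hTd hp), heven,
        (Finset.mem_filter.1 hx).2⟩
  -- Step 2: the pieces are pairwise disjoint (`T ↦ z_T` injective) and have `|H|` elements each (`z_T ∈ χ(G)`)
  rw [hΔ, Finset.card_biUnion]
  · rw [Finset.sum_const_nat fun T hT => ?_, card_powerset_filter_even]
    have hTd := Finset.mem_powerset.1 (Finset.mem_filter.1 hT).1
    have hmem : rootProd T ∈ im :=
      (mem_image_iff_pow_eq_one χ _).2 ((rootProd_pow_eq_one_iff (hprime hTd) _).2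
        fun p hp => Nat.dvd_of_mem_primeFactors (hTd hp))
    obtain ⟨x₀, -, hx₀⟩ := Finset.mem_image.1 hmem
    exact card_filter_char_eq χ hx₀
  · intro T hT T' hT' hne
    rw [Function.onFun, Finset.disjoint_filter]
    intro x _ hx hx'
    exact hne (rootProd_injective_of_prime (hprime (Finset.mem_powerset.1 (Finset.mem_filter.1 hT).1))
      (hprime (Finset.mem_powerset.1 (Finset.mem_filter.1 hT').1)) (hx.symm.trans hx'))

/-- **The size of White's set for `N' = |G|`** (the set of `exists_sporadic_of_oddCharacter` /
`typeRank_ne_iff_exists_sporadic`): `|whiteSet |G| χ| = 2^{ω(N)−1}·|H|`, `N = |χ(G)|`, `H = ker χ`.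
[cite: White1993SporadicCycles, §4 Lemma 3 and Theorem 3 (proofs)] -/
theorem card_whiteSet_card (χ : AddChar (Additive G) ℂ) :
    (whiteSet (Fintype.card G) χ).card =
      2 ^ ((Finset.univ.image fun x : G => χ (Additive.ofMul x)).card.primeFactors.card - 1) *
        (Finset.univ.filter fun x : G => χ (Additive.ofMul x) = 1).card :=
  card_whiteSet χ Fintype.card_ne_zero ⟨_, (card_image_mul_card_ker χ).symm⟩

/-- **The same against `|G|`**: `|whiteSet |G| χ|·N = 2^{ω(N)−1}·|G|` with `N = |χ(G)| = [G : ker χ]` (`|G| = N·|H|`),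
i.e. `|Δ| = 2^{ω(N)−1}|G|/N`; for an ODD `χ` (`χ(c) = −1`, `2 ∣ N`) this is twice the codimension
`m = 2^{ω(N)−2}·|G|/N` (resp. `|G|/4` when `N = 2`) of the sporadic class carried by `Δ`.
[cite: White1993SporadicCycles, §4 Lemma 3 and Theorem 3 (proofs)] -/
theorem card_whiteSet_card_mul (χ : AddChar (Additive G) ℂ) :
    (whiteSet (Fintype.card G) χ).card * (Finset.univ.image fun x : G => χ (Additive.ofMul x)).card =
      2 ^ ((Finset.univ.image fun x : G => χ (Additive.ofMul x)).card.primeFactors.card - 1) *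
        Fintype.card G := by
  rw [card_whiteSet_card, ← card_image_mul_card_ker χ]
  ring

end Count

end WhiteLenstra

end Literature.NumberTheory.ComplexMultiplication

end
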